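import Literature.AnabelianGeometry.EtaleTheta.Discharge.Sec5Thm57FinalKnitV4
import Literature.AnabelianGeometry.EtaleTheta.Discharge.Sec5Thm57GenuineBindersAConstAnchor
import Literature.AnabelianGeometry.EtaleTheta.Discharge.Sec5Thm57CoherentFamilyOfRebaseAnchoredIsoConst

/-!
# [EtTh] §5, Theorem 5.7 at the genuine connected tower — FINAL KNIT v5: the per-anchor column read at the PRODUCED anchor, whose
# discrepancy unit is a CONSTANT — `hcfix` GONE (Def. 3.6 (iii), a theorem for base-curve constants), `hsurj` := PRINT'S LEMMA 5.8 FOR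
# CONSTANTS «(K^×)^{1/N} ⊆ O^×(B_N^birat)», `hivPiso` := Prop. 4.2 (iv) across the anchor (pp. 315–316, 329–331 / PDF pp. 89–90, 103–105)

Mochizuki, *The étale theta function …*, Publ. RIMS **45** (2009) [cite: MochizukiEtTh2009, Thm 5.7 p.330 (PDF p.104); Thm 5.6 proof
p.329 (PDF p.103); Lem 5.8 p.331 (PDF p.105); Rmk 4.3.2 p.318–319 (PDF pp.92–93); Prop 4.2 (iv) p.315 (PDF p.89), proof p.316 (PDF p.90);
Def 3.6 (iii) p.303 (PDF p.77)].  abc-iut cell, layer L2, node `EtTh:Thm5.7`; abc-iut-L2-lead (gen 5) R719 «HCFIX@PRODUCED-ANCHOR» = GO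
(seat abc-iut-f-123 gen 6).  PROOF-ONLY (0 definitions, 0 new named facts; nothing landed is edited or restated).
THE RESHAPE.  v1–v4 asked their per-anchor root binders (`hroot₁N` → `hsurj`/`hcfix`, `hivP′` → `hivPiso`) for EVERY normalised anchor
`(α₁, β₁, u₁)` with `u₁` an ARBITRARY unit of `B_1`.  The capstone consumes them at ONE anchor — PRODUCED at the first root (abc-iut-w5-d245
p437125) — whose discrepancy unit IS A CONSTANT `c ∈ K^×` (Thm. 5.7 rigidity / Lemma 5.8 at `N₁ = 1`, abc-iut-L2-t4's
`discrepancy_mem_OKxRootN`; `Sec5Thm57AnchoredFamilyConstAnchor.lean` → `exists_const_of_normalisedAnchor`).  This knit composes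
* the CONSTANT-ANCHORED capstone `…_ofConstAnchored_genuine_of_constantsDictionary` (`Sec5Thm57GenuineBindersAConstAnchor.lean`) and
  FILE 2 `hfam_ofConnectedTemperoidFamily_of_rebase_anchored_iso_const` (`Sec5Thm57CoherentFamilyOfRebaseAnchoredIsoConst.lean`),
* at a constant anchor `u_{u₁} = (t 1)^*(c₀ c)`: the root clause from abc-iut-f-123's `NthRoot.hroot₁N_clause_iff_of_unit_eq` (p455663 §5:
  the fixedness half — Def. 3.6 (iii) for base-curve constants — is a THEOREM, `isFixedByHA_pullFrac_pullFrac_unit_of_unit_eq`; the root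
  half IS «`c` has an `N`-th root in `B(B_N^bs)^×`»), fed by **`h58N` = PRINT'S LEMMA 5.8 FOR CONSTANTS**: «`(K^×)^{1/N} ⊆ O^×(B_N^birat)`»
  — for every level `N` and constant `c ∈ K'^×`, `(t N)^*(c₀ c)` has an `N`-th root in `B(B_N^bs)^×`;
* Prop. 4.2 (iv) across the anchor (abc-iut-f-123 `Prop42Sub.prop42_iv_iso_of_unitRootsUpstairsAt`, p469135) with its L05 input at the
  twisted level-1 root from the roots-of-constants law `hL` over `A_1` (abc-iut-w4-d044 p457540), exactly as v4.
RESULT `thetaRootPreservedAll_ofConnectedTemperoidYddFamily_final_v5`: Thm. 5.7 (root level, all identifications) at every level of the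
genuine tower MODULO: (A) `hnd` + the junction data of record {`hc₀`, `ht`; `hD₁`, `hY₁`; `cnst`, `G`, `ecn`, `hP34`, `hYdd`}; `hF`,
`hαover`; (anchor) `hcharAN`, `hdivA`, `hP24`; (§4) `h44`, `ψ`, `hpull`, `hii`, `h3`, `h4b`, `h8`, `h15a`, `h15`, `D N`; **`h58N`**
(Lemma 5.8 for constants, print verbatim); `hL` (ONLY as Prop. 4.2 (iv)'s L05 input at the twisted root over `A_1`; GAP G-w4d044-1 shape);
(C) `hc`.  GONE vs v4: `hcfix`; the law `hL` no longer feeds the Lemma-5.8 half.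
HONEST FRAMING: kernel-checked composition of landed theorems for data so parametrised (no instance of `TemperedFrobenioid T₀ (ConnectedPart
(BTemp X.Pi)) VD` for an actual curve is constructed here); `h58N`/`hL` are hypotheses on the free data (`tf.ratFnFunctor`, the `(N, H)`-slot
`NH`); nothing asserts any result of [EtTh] unconditionally; typed ≠ discharged — PROVED modulo the displayed binders; no side taken on
anything downstream ([IUTchIII] Cor. 3.12 in particular).
-/

noncomputable section

namespace Literature.AnabelianGeometry.EtaleTheta

open CategoryTheory Opposite Literature.AlgebraicGeometry.Frobenioids Literature.AnabelianGeometry.SemiGraphs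
  Literature.AnabelianGeometry.SemiGraphs.GaloisObjects

universe v₀ u₁ v₁

namespace ThetaFrobenioidTower

section DictionaryV5

variable {K : Type} [Field K] {X : SemiGraphs.TemperedArithmeticGroup.{0} K} {D₀ : Type} [Category.{v₀} D₀]
  {V : FrdIMonoidStub.{0}} {T₀ : RealifiedDivisorMonoids (D₀ := D₀) V}
  {VD : FrdICatStub.{1, 0, 0} (ConnectedPart (BTemp X.Pi))}
  {tf : TemperedFrobenioid T₀ (ConnectedPart (BTemp X.Pi)) VD} {hZ : tf.monoidType = MonoidType.Z}
  {hP : ∀ A : (ConnectedPart (BTemp X.Pi))ᵒᵖ, IsPerfect (tf.Φ.carrier A)}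
  {NH : Subgroup (Field.absoluteGaloisGroup K) → tf.category → ℕ+ → Prop}
  {E : Set ℕ+} (𝒯 : ThetaEnvTower.{0} E) (ιX : 𝒯.PiX ≃ₜ* X.Pi)
  {pullFrac : ∀ {A A' : (BiKummerSetting.mkOfConnectedTemperoidYddTower X tf hZ hP NH 𝒯 ιX).C} (_ : A' ⟶ A),
    (BiKummerSetting.mkOfConnectedTemperoidYddTower X tf hZ hP NH 𝒯 ιX).biratUnits A →
      (BiKummerSetting.mkOfConnectedTemperoidYddTower X tf hZ hP NH 𝒯 ιX).biratUnits A'}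
  {lv : ℕ+}
  {θ : (BiKummerSetting.mkOfConnectedTemperoidYddTower X tf hZ hP NH 𝒯 ιX).biratUnits
    (BiKummerSetting.mkOfConnectedTemperoidYddTower X tf hZ hP NH 𝒯 ιX).Aodot}
  {Bl : (BiKummerSetting.mkOfConnectedTemperoidYddTower X tf hZ hP NH 𝒯 ιX).C}
  {Pl : (BiKummerSetting.mkOfConnectedTemperoidYddTower X tf hZ hP NH 𝒯 ιX).FractionPair θ Bl}
  {Rl : (BiKummerSetting.mkOfConnectedTemperoidYddTower X tf hZ hP NH 𝒯 ιX).NthRoot θ Pl lv pullFrac}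
  (h : ModelFrobenioid.Hypotheses tf.divisorMonoid tf.ratFnFunctor)
  (Q : FrobenioidTheta.ThetaSubquotientStub.{0} (ConnectedPart (BTemp X.Pi))) (odd_l : Odd (lv : ℕ))
  (R : ∀ N : ℕ+, (BiKummerSetting.mkOfConnectedTemperoidYddTower X tf hZ hP NH 𝒯 ιX).NthRoot Rl.root Rl.pair N pullFrac)
  (K' : Type) [Field K'] {X₀ : ConnectedPart (BTemp X.Pi)}
  (hX₀ : ∀ Y : ConnectedPart (BTemp X.Pi), Subsingleton (Y ⟶ X₀)) (t : ∀ N : ℕ+, (R N).BN.base ⟶ X₀)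
  (c₀ : K'ˣ →* (tf.ratFnFunctor.obj (op X₀))ˣ)
  (hc₀ : Function.Injective c₀) (ht : ∀ N : ℕ+, Function.Injective (tf.ratFnFunctor.map (t N).op).hom)
  (hinvc : ∀ (N : ℕ+) (g : Aut (R N).AN.base),
    pull tf.divisorMonoid g.hom (ModelFrobenioid.div (R N).pair.num) = ModelFrobenioid.div (R N).pair.num)
  (hinvp : ∀ (N : ℕ+) (y : 𝒯.PiX), y ∈ 𝒯.PiYdd →
    pull tf.divisorMonoid ((BiKummerSetting.mkOfConnectedTemperoidYddTower X tf hZ hP NH 𝒯 ιX).galoisSurj (R N).AN.base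
      (R N).αData.isGalois (ιX y)).hom (ModelFrobenioid.div (R N).pair.den) = ModelFrobenioid.div (R N).pair.den)
  (α : ∀ {N N' : ℕ+}, (N : ℕ) ∣ N' → ((R N').AN ⟶ (R N).AN))
  (β : ∀ {N N' : ℕ+}, (N : ℕ) ∣ N' → ((R N').BN ⟶ (R N).BN))
  (comm_sCap : ∀ {N N' : ℕ+} (hd : (N : ℕ) ∣ N'), (R N').pair.num ≫ β hd = α hd ≫ (R N).pair.num)
  (comm_sCup : ∀ {N N' : ℕ+} (hd : (N : ℕ) ∣ N'), (R N').pair.den ≫ β hd = α hd ≫ (R N).pair.den)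
  (isIsometry_α : ∀ {N N' : ℕ+} (hd : (N : ℕ) ∣ N'),
    ((BiKummerSetting.mkOfConnectedTemperoidYddTower X tf hZ hP NH 𝒯 ιX).sec5Stub h).pre.IsIsometry (α hd))
  (degFr_α : ∀ {N N' : ℕ+} (hd : (N : ℕ) ∣ N'),
    (((BiKummerSetting.mkOfConnectedTemperoidYddTower X tf hZ hP NH 𝒯 ιX).sec5Stub h).pre.degFr (α hd) : ℕ) * N = N')
  (isIsometry_β : ∀ {N N' : ℕ+} (hd : (N : ℕ) ∣ N'),
    ((BiKummerSetting.mkOfConnectedTemperoidYddTower X tf hZ hP NH 𝒯 ιX).sec5Stub h).pre.IsIsometry (β hd))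
  (degFr_β : ∀ {N N' : ℕ+} (hd : (N : ℕ) ∣ N'),
    (((BiKummerSetting.mkOfConnectedTemperoidYddTower X tf hZ hP NH 𝒯 ιX).sec5Stub h).pre.degFr (β hd) : ℕ) * N = N')
  (baseFrob_α : ∀ {N N' : ℕ+} (hd : (N : ℕ) ∣ N'),
    (BiKummerSetting.mkOfConnectedTemperoidYddTower X tf hZ hP NH 𝒯 ιX).IsOfBaseFrobeniusType (α hd))
  -- the §1 Setting against which the constants of `B_1` are read (abc-iut-L2-t8's model `Cu.thetaEnvData μ₁ hC hS`)
  {p : ℕ} [Fact p.Prime] {DS : ThetaSetting p} {ES : DS.EtaleThetaData} {l' : ℕ} (Cu : ES.DoubleUnderline l')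
  (hC : DS.Compat) (hS : DS.Sec2Hyps)
  (h44 : BiKummerSetting.Thm44Hyp (BiKummerSetting.mkOfConnectedTemperoidYddTower X tf hZ hP NH 𝒯 ιX)
    (BiKummerSetting.mkOfConnectedTemperoidYddTower X tf hZ hP NH 𝒯 ιX))
  (ψ : ∀ A : (BiKummerSetting.mkOfConnectedTemperoidYddTower X tf hZ hP NH 𝒯 ιX).C,
    (BiKummerSetting.mkOfConnectedTemperoidYddTower X tf hZ hP NH 𝒯 ιX).biratUnits A ≃*
      (BiKummerSetting.mkOfConnectedTemperoidYddTower X tf hZ hP NH 𝒯 ιX).biratUnits (h44.Ψ.functor.obj A))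
  (hpull : ∀ {A A' : (BiKummerSetting.mkOfConnectedTemperoidYddTower X tf hZ hP NH 𝒯 ιX).C} (φ : A' ⟶ A)
    (f : (BiKummerSetting.mkOfConnectedTemperoidYddTower X tf hZ hP NH 𝒯 ιX).biratUnits A),
      ψ A' (pullFrac φ f) = pullFrac (h44.Ψ.functor.map φ) (ψ A f))
  (hii : BiKummerSetting.Thm44_ii h44 ψ) (h3 : h44.PreservesFrobeniusStructure) (h4b : h44.PreservesBaseFrobeniusTypeData)
  (h8 : h44.PreservesAmple) (h15a : h44.PreservesFixedByHA ψ) (h15 : h44.PreservesSaturated ψ)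
  -- (B1)/(B1′): the Def. 4.1 (iv) datum of each transition `α_{1,N}` and its pull-back compatibility
  (D : ∀ N : ℕ+, (BiKummerSetting.mkOfConnectedTemperoidYddTower X tf hZ hP NH 𝒯 ιX).BaseFrobeniusTypeData (α (one_dvd_level N)))

include hX₀ h hc₀ ht comm_sCap comm_sCup isIsometry_α degFr_α isIsometry_β degFr_β hpull hii h3 h4b h8 h15a h15 D in
/-- **[EtTh] Theorem 5.7 at the genuine connected tower — FINAL KNIT v5** (per-anchor column at the PRODUCED, constant anchor: `hcfix` GONE,
Lemma 5.8 for constants `h58N` print-verbatim, Prop. 4.2 (iv) across the anchor with `hL` as its L05 input only; see the module docstring).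
[cite: MochizukiEtTh2009, Thm 5.7 p.329–330 (PDF pp.103–104); Lem 5.8 p.331 (PDF p.105); Prop 4.2 (iv) p.315–316 (PDF pp.89–90); Def 3.6 (iii) p.303 (PDF p.77)] -/
theorem thetaRootPreservedAll_ofConnectedTemperoidYddFamily_final_v5
    (T : ThetaFrobenioidTower.{0} (BiKummerSetting.mkOfConnectedTemperoidYddTower X tf hZ hP NH 𝒯 ιX).C
      (ConnectedPart (BTemp X.Pi)))
    (hT : T = ofConnectedTemperoidFamily h Q odd_l R ιX K' (fun N => (Units.map (tf.ratFnFunctor.map (t N).op).hom).comp c₀)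
      (fun N => tf.unitsMap_comp_injective (t N) hc₀ (ht N)) hinvc hinvp α β comm_sCap comm_sCup isIsometry_α degFr_α
      isIsometry_β degFr_β baseFrob_α)
    (hnd : IsNonDilatingOn tf.divisorMonoid)
    -- (A) `hgc₁` RE-KEYED (abc-iut-w5-d123 p447915): the ONE `ConstantsDictionary` junction binder at the first root + `hY₁`
    {μ₁ : DS.CyclotomeMod l' (T.atLevel 1).N} {ι₁ : (T.atLevel 1).PiX ≃ₜ* (Cu.thetaEnvData μ₁ hC hS).PiX}
    {m₁ : (T.atLevel 1).muTorsion (T.atLevel 1).BN (T.atLevel 1).N ≃* (Cu.thetaEnvData μ₁ hC hS).mu}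
    (act₁ : (T.atLevel 1).BiratAutAction) {Cst₁ : Subgroup ((T.atLevel 1).biratUnits (T.atLevel 1).BN)}
    {ν₁ : Cst₁ →* (PadicAlgCl p)ˣ}
    (hD₁ : ThetaFrobenioid.BiratAutAction.ConstantsDictionary act₁ Cu μ₁ hC hS ι₁ m₁ Cst₁ ν₁)
    (hY₁ : (T.atLevel 1).IdentifiesPiY (Cu.thetaEnvData μ₁ hC hS) ι₁.toMulEquiv)
    -- (A) `hfac₁` RE-KEYED (abc-iut-w5-d123 p447915): Prop. 3.4 (ii), the identification `D → D₀ → D^cnst ≅ aug_* ⋙ G`, and `hYdd`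
    {Dcnst : Type u₁} [Category.{v₁} Dcnst] (cnst : D₀ ⥤ Dcnst) (G : ConnectedPart (BTemp (Field.absoluteGaloisGroup K)) ⥤ Dcnst)
    (ecn : tf.base ⋙ cnst ≅ QuasiTemperoid.pushforward X.aug.toMonoidHom X.aug_surjective X.augIsOpenMap_holds ⋙ G)
    (hP34 : RealifiedDivisorMonoids.Prop34Cnst T₀ cnst)
    (hYdd : ∀ y : 𝒯.PiX, ∃ k ∈ 𝒯.PiYdd, X.aug (ιX k) = X.aug (ιX y))
    -- the rendering law of `pullFrac` (the model's `((·)^birat)^*`), the transitions over the base pair, and the Prop. 2.4-class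
    -- clause at the chosen first root ("`S₂^bs` characteristic", p.329): these DISCHARGE `hpull₂`, `hD`, `hf`, `hΨFT`, `hbs` of `…_final`
    (hF : ∀ {B B' : (BiKummerSetting.mkOfConnectedTemperoidYddTower X tf hZ hP NH 𝒯 ιX).C} (φ : B' ⟶ B)
      (y : (BiKummerSetting.mkOfConnectedTemperoidYddTower X tf hZ hP NH 𝒯 ιX).biratUnits B), pullFrac φ y = tf.pullFracModel φ y)
    (hαover : ∀ N : ℕ+, α (one_dvd_level N) ≫ (R 1).α = (R N).α)
    -- «`A_N^bs` characteristic» at EVERY level (the [EtTh] Prop. 2.4-class clause; its `N = 1` instance is v2's `hcharN`; it yields v2's `hebs`)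
    (hcharAN : ∀ N : ℕ+, IsTopCharacteristic X.Pi (galoisSurjOf X.isTempered (R N).AN.base.obj (R N).αData.isGalois).ker)
    (hdivA : ∀ αA : h44.Ψ.functor.obj (T.AN 1) ≅ T.AN 1, ∃ ε : Aut (T.AN 1),
      T.pre.div (αA.inv ≫ h44.Ψ.functor.map (T.sCap 1)) = T.pre.div (ε.hom ≫ T.sCap 1) ∧
      T.pre.div (αA.inv ≫ h44.Ψ.functor.map (T.sCup 1)) = T.pre.div (ε.hom ≫ T.sCup 1))
    (hP24 : ∀ γ : 𝒯.PiX ≃ₜ* 𝒯.PiX, 𝒯.PiYdd.map γ.toMulEquiv.toMonoidHom = 𝒯.PiYdd)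
    -- [EtTh] LEMMA 5.8 FOR CONSTANTS, print verbatim: «(K^×)^{1/N} ⊆ O^×(B_N^birat)» — every constant `c ∈ K'^×` read on `B_N^bs` (along
    -- `t N`) has an `N`-th root in `B(B_N^bs)^×` (p.331 (PDF p.105)); it feeds the root clause at the PRODUCED anchor, whose discrepancy
    -- unit is a constant (the fixedness half, Def 3.6 (iii), is then a theorem — abc-iut-f-123 p455663)
    (h58N : ∀ (N : ℕ+) (c : K'ˣ), ∃ r : tf.biratUnitsModel (R N).BN,
      (r : tf.ratFnFunctor.obj (op (R N).BN.base)) ^ (N : ℕ) = (tf.ratFnFunctor.map (t N).op).hom (c₀ c : tf.ratFnFunctor.obj (op X₀)))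
    -- [EtTh] Prop 4.2 (iv) L05 input OVER THE DOMAIN `A_1` of the twisted level-1 pair: the roots-of-constants law (abc-iut-w4-d044's
    -- `hL`, G-w4d044-1's shape at `A := A_1`; [FrdII] Rmk 2.2.1) — consumed ONLY by `Prop42Sub.unitRootsUpstairsAt_of_constantRootsAt`
    (hL : ∀ (A'' : (BiKummerSetting.mkOfConnectedTemperoidYddTower X tf hZ hP NH 𝒯 ιX).C) (N : ℕ+)
      (g : A''.base ⟶ (R 1).AN.base) (ξ : tf.ratFnFunctor.obj (op (R 1).AN.base)),
      (BiKummerSetting.mkOfConnectedTemperoidYddTower X tf hZ hP NH 𝒯 ιX).IsFrobeniusTrivial A'' →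
      (BiKummerSetting.mkOfConnectedTemperoidYddTower X tf hZ hP NH 𝒯 ιX).IsNHSaturatedBsFld
        (BiKummerSetting.mkOfConnectedTemperoidYddTower X tf hZ hP NH 𝒯 ιX).HodotBsFld A'' N →
      divB tf.divisorMonoid tf.ratFnFunctor tf.divBNatTrans (op (R 1).AN.base) ξ = 1 →
        ∃ ζ : tf.ratFnFunctor.obj (op A''.base), ζ ^ (N : ℕ) = pull tf.ratFnFunctor g ξ)
    -- (C): the level-1 discrepancy constant of every normalised transport is a `2l`-th root of unity
    (hc : ∀ (α₁ : h44.Ψ.functor.obj (T.AN 1) ≅ T.AN 1) (β₁ : h44.Ψ.functor.obj (T.BN 1) ≅ T.BN 1) (u₁ : Aut (T.BN 1))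
      (hu₁ : u₁ ∈ (T.atLevel 1).units (T.BN 1)),
      α₁.inv ≫ h44.Ψ.functor.map (T.sCap 1) ≫ β₁.hom = T.sCap 1 →
      α₁.inv ≫ h44.Ψ.functor.map (T.sCup 1) ≫ β₁.hom = T.sCup 1 ≫ u₁.hom →
        ∀ c : T.Kˣ, (T.atLevel 1).unitsToBirat (T.BN 1) ⟨u₁, hu₁⟩ = T.constEmb 1 c → c ^ (2 * T.l) = 1) :
    T.ThetaRootPreservedAll h44.Ψ := by
  -- `deg_Fr(α_{1,N}) = N = deg_Fr(β_{1,N})` from the tower's degree laws at `(1, N)`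
  have hdeg : ∀ {d N : ℕ+}, (d : ℕ) * ((1 : ℕ+) : ℕ) = N → d = N := fun hd => by
    rw [PNat.one_coe, mul_one] at hd
    exact PNat.coe_inj.mp hd
  have hD : ∀ N : ℕ+, pullFrac (D N).α₁ (R 1).root = pullFrac (R N).αData.α₁ Rl.root := fun N =>
    BiKummerSetting.NthRoot.rebase_hD_of_comp X tf hZ hP _ _ _ NH _ _ _ hF (R N) (R 1) (α (one_dvd_level N)) (D N) (hαover N)
  -- the (r4) ANCHORED coherent family WITHOUT `hArises`; `hebs` from «`A_N^bs` characteristic» (p453958)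
  have hfam := hfam_ofConnectedTemperoidFamily_of_rebase_anchored_iso_const 𝒯 ιX h Q odd_l R K' t c₀
    (fun N => tf.unitsMap_comp_injective (t N) hc₀ (ht N)) hinvc hinvp α β comm_sCap comm_sCup isIsometry_α degFr_α isIsometry_β
    degFr_β baseFrob_α h44 ψ hpull hii h3 h4b h8 h15a h15 D hD T hT
    (fun α₁ β₁ u₁ hu₁ hnum hden _ _ =>
      BiKummerSetting.FractionPair.hf_of_normalisedAnchor X tf hZ hP _ _ _ NH _ _ _ hF h44 ψ hii (R 1).pair u₁ hu₁ rfl α₁ β₁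
        hnum hden)
    (hebs_of_isTopCharacteristic 𝒯 ιX h R α h44 hnd hcharAN)
    (fun α₁ β₁ u₁ hu₁ hnum hden c hux N => by
      -- the level-`N` root rebased over the level-1 pair (abc-iut-f-121's `NthRoot.rebase`, p443132)
      let Rt := (R N).rebase (R 1) (α (one_dvd_level N)) (β (one_dvd_level N)) (comm_sCap (one_dvd_level N))
        (comm_sCup (one_dvd_level N)) (isIsometry_α (one_dvd_level N)) (isIsometry_β (one_dvd_level N))
        (hdeg (degFr_α (one_dvd_level N))) (hdeg (degFr_β (one_dvd_level N))) (D N) (hD N)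
      -- the root clause at the CONSTANT anchor `u_{u₁} = (t 1)^*(c₀ c)`: its fixedness half is a theorem (Def 3.6 (iii) for base-curve
      -- constants) and its root half is Lemma 5.8 for the constant `c` at level `N` (abc-iut-f-123's `NthRoot.hroot₁N_clause_iff_of_unit_eq`)
      obtain ⟨ut, hut, hover, hfix⟩ :=
        (BiKummerSetting.NthRoot.hroot₁N_clause_iff_of_unit_eq X tf hZ hP _ _ _ NH _ _ _ h hX₀ hF Rt u₁ hu₁ (t 1) (t N) (c₀ c)
          hux).mpr (h58N N c)
      have hpow := BiKummerSetting.pow_twistRoot_eq_pullFrac_of_rendering X tf hZ hP _ _ _ NH _ _ _ hF Rt u₁ hu₁ ut hut hover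
      exact ⟨ut, hut, hover, hpow, BiKummerSetting.isSaturated_twist_of_fixed Rt hpow hfix⟩)
    (fun _ _ _ _ _ _ _ _ N _ _ _ _ R' R₂ eA eB hn hd _ ebs hebs =>
      -- [EtTh] Prop. 4.2 (iv) ACROSS the isomorphism of pairs (abc-iut-f-123 p469135), Def. 4.1 (iv)(e) read canonically, its L05
      -- input at the twisted level-1 root `R'` from the law `hL` over `A_1` (abc-iut-w4-d044, p457540) — as in v4
      BiKummerSetting.Prop42Sub.prop42_iv_iso_of_unitRootsUpstairsAt
        (BiKummerSetting.mkOfConnectedTemperoidYddTower X tf hZ hP NH 𝒯 ιX) pullFrac h.isDivisorial (fun _ _ _ hh => hh) R'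
        (BiKummerSetting.Prop42Sub.unitRootsUpstairsAt_of_constantRootsAt
          (BiKummerSetting.mkOfConnectedTemperoidYddTower X tf hZ hP NH 𝒯 ιX) pullFrac h.isDivisorial
          (tf.isGroupLike_ratFnFunctor T₀.isUnit_BΛ) hL _ _ N R')
        R₂ eA eB hn hd ebs hebs)
  subst hT
  obtain ⟨αs, βs, -, hdivcap₁, hdivcup₁⟩ :=
    ThetaFrobenioid.exists_seeds_hdivcapcup_ofConnectedTemperoidData_of_isTopCharacteristic (T := 𝒯.level ⟨1, 𝒯.one_mem⟩) h Q
      odd_l (R 1) ιX K' ((Units.map (tf.ratFnFunctor.map (t 1).op).hom).comp c₀) (tf.unitsMap_comp_injective (t 1) hc₀ (ht 1))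
      (hinvc 1) (hinvp 1) h44 hnd h3 (hcharAN 1) hdivA
  exact thetaRootPreservedAll_ofConnectedTemperoidYddFamily_ofConstAnchored_genuine_of_constantsDictionary 𝒯 ιX h Q odd_l R K'
    hX₀ t
    c₀ hc₀ ht hinvc hinvp α β comm_sCap comm_sCup isIsometry_α degFr_α isIsometry_β degFr_β baseFrob_α Cu hC hS _ rfl hnd act₁
    hD₁ hY₁ h44.Ψ cnst G ecn hP34 hYdd αs βs hdivcap₁ hdivcup₁ hP24 hfam hc

end DictionaryV5

end ThetaFrobenioidTower

end Literature.AnabelianGeometry.EtaleTheta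

end
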